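import Literature.Computability.QuantumComplexity.KeyedOracleTruncatedRun
import Literature.Computability.QuantumComplexity.RetargetBlocks
import Literature.Computability.Cryptography.QubitRegisterCliffordTProofs
import HarnessLib

/-!
# Keyed runs on DISJOINT BLOCKS sharing one classical prefix: key-averaged block events and truncated-run query magnitudes

Topic `Literature/Computability/QuantumComplexity`; assembly of `KeyedOracleRun.lean` (Hadamards on the key wires, then
a circuit keeping the prefix classical: the output statistics are the AVERAGE over the keys of the branch statistics,
`sum_normSq_hadamards_then_keyDiagonal`; one re-targeted block, `sum_normSq_hadamards_retarget_eq_avg_event`),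
`RetargetBlocks.lean` (several circuits re-targeted to the SAME prefix register and transported to pairwise disjoint
blocks: an event read on one block has that block's own probability, `sum_normSq_flatMap_retarget_block_event`) and
`QueryWeightsTruncation.lean` / `KeyedOracleTruncatedRun.lean` (the `t`-th BBBV query magnitude is the probability that
the query register of the `t`-th oracle gate, measured after the TRUNCATED run, spells a string of `D`). Laying the
truncations of an oracle algorithm before each of its oracle gates side by side on disjoint blocks (each block holding
its own copy of the input), after Hadamards on shared key wires, gives ONE circuit whose block-`t` query-register
statistic is the key-average of the `t`-th query magnitude of the original algorithm relative to the keyed oracles —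
the "one copy = one truncated run per oracle gate" estimator of Bennett–Bernstein–Brassard–Vazirani 1997 (proof of
Cor. 3.4 / Thm. 3.5: "run the machine until just before the `i`-th query and measure the query tape"), in the keyed form
used when the random oracle is a random member of a hash family (Zhandry 2012, Thm. 3.1).

* **`sum_normSq_hadamards_flatMap_retarget_block_event`** — blocks `E b` (`b < M`) pairwise disjoint and off the
  prefix `p`, key wires `t.trans p`, basis input `w` with `w ∘ E b = x 0^m` for every block and `0` on the key wires:
  the probability that block `b` shows the event `T` after `(H on the key wires) ++ flatMap_b retarget p (E b) (pre b)`,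
  relative to `A`, is `2^{-κ} Σ_key Σ_{u : T u} |(U_{pre b}^{A⟨c_key⟩})(u, x 0^m)|²`;
* **`sum_normSq_hadamards_flatMap_retarget_block_queryWeight`** — with `pre b` the truncation of `gs` before its `b`-th
  oracle gate (`oraclePositions`) and `T` = "the query register of that gate spells a string of `D`": the block-`b`
  probability is `2^{-κ} Σ_key (queryWeights A⟨c_key⟩ D gs |x 0^m⟩)[b]`, the key-average of the `b`-th query magnitude.

Everything here is PROVED; no definition, no named fact.

## References

* C. H. Bennett, E. Bernstein, G. Brassard, U. Vazirani, *Strengths and weaknesses of quantum computing*, SIAM J.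
  Comput. 26 (1997) 1510–1523, Def. 3.2, Cor. 3.4, Thm. 3.5 (proof), §4 [BennettBernsteinBrassardVazirani1997].
* M. Zhandry, *Secure identity-based encryption in the quantum random oracle model*, CRYPTO 2012, Thm. 3.1 [Zhandry2012].
* M. A. Nielsen, I. L. Chuang, *Quantum Computation and Quantum Information*, CUP 2010, §2.2.8, §4.3 [NielsenChuang2010].
-/

noncomputable section

namespace Literature.Computability.QuantumComplexity

open Cryptography Matrix Finset

/-- **Key-averaged block events for keyed runs on disjoint blocks.** Blocks `E b : Fin (n+m) ↪ Fin N` (`b < M`)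
pairwise disjoint and disjoint from the prefix wires `p`; key wires `t.trans p`; a basis input `w` whose restriction to
every block is `x 0^m` and which is `0` on the key wires. After `(H on the key wires) ++ flatMap_b retarget p (E b) (pre b)`
relative to `A`, the probability that block `b` shows `T` is
`2^{-κ} Σ_key Σ_{u : T u} |(U_{pre b}^{A⟨c_key⟩})(u, x 0^m)|²`, `c_key = (assignKey (t.trans p) w key) ∘ p`.
[cite: Zhandry2012, Thm. 3.1] [cite: NielsenChuang2010, §2.2.8] [cite: BennettBernsteinBrassardVazirani1997, §4] -/
theorem sum_normSq_hadamards_flatMap_retarget_block_event {n m N P κ M : ℕ}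
    (pre : Fin M → List (QGate cliffordT (n + m)))
    (p : Fin P ↪ Fin N) (E : Fin M → (Fin (n + m) ↪ Fin N)) (hdisj : ∀ b a i, p a ≠ E b i) (hE : BlockDisjoint E)
    (t : Fin κ ↪ Fin P) (A : Language Bool) (w : QReg N) (x : QReg n) (hwx : ∀ b, w ∘ E b = padInput x m)
    (hw0 : ∀ j, w ((t.trans p) j) = false) (b : Fin M) (T : QReg (n + m) → Prop) [DecidablePred T] :
    (∑ y ∈ univ.filter (fun y : QReg N => T (y ∘ E b)),
        ‖((⟨(List.ofFn (t.trans p)).map hOn ++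
            (List.finRange M).flatMap fun b => retarget p (E b) (hdisj b) (pre b)⟩ : QCircuit cliffordT N).toMatrix A *ᵥ
          basisState w) y‖ ^ 2) =
      (1 / 2 : ℝ) ^ κ * ∑ key : QReg κ, ∑ u : QReg (n + m),
        if T u then ‖(⟨pre b⟩ : QCircuit cliffordT (n + m)).toMatrix
          (prefixSlice A (List.ofFn (assignKey (t.trans p) w key ∘ p))) u (padInput x m)‖ ^ 2 else 0 := by
  classical
  have hbody : KeyDiagonal (t.trans p)
      ((⟨(List.finRange M).flatMap fun b => retarget p (E b) (hdisj b) (pre b)⟩ : QCircuit cliffordT N).toMatrix A) :=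
    (keyDiagonal_flatMap_retarget p E hdisj A pre (List.finRange M)).of_trans t
  rw [sum_normSq_hadamards_then_keyDiagonal (t.trans p) _ A hbody w hw0]
  congr 1
  refine Finset.sum_congr rfl fun key _ => ?_
  rw [Finset.sum_filter,
    sum_normSq_flatMap_retarget_block_event p E hdisj cliffordT_isUnitary_holds A hE pre (assignKey (t.trans p) w key) b T,
    assignKey_comp_emb p (E b) (hdisj b) t w key, hwx b]
  refine Finset.sum_congr rfl fun u _ => ?_
  rw [mulVec_basisState]

/-- **Key-averaged query magnitudes from truncated runs on disjoint blocks.** In the setting of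
`sum_normSq_hadamards_flatMap_retarget_block_event`, let block `b` run the truncation of `gs` before its `b`-th oracle
gate (`pre b = ((oraclePositions gs)[b]).1` whenever `b < #oracle gates`). Then the probability that the transported query
register of that gate spells a string of `D` on block `b` is `2^{-κ} Σ_key (queryWeights A⟨c_key⟩ D gs |x 0^m⟩)[b]` —
the key-average of the `b`-th BBBV query magnitude of `gs`.
[cite: BennettBernsteinBrassardVazirani1997, Def. 3.2, Cor. 3.4] [cite: Zhandry2012, Thm. 3.1] -/
theorem sum_normSq_hadamards_flatMap_retarget_block_queryWeight {n m N P κ M : ℕ}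
    (gs : List (QGate cliffordT (n + m))) (pre : Fin M → List (QGate cliffordT (n + m)))
    (p : Fin P ↪ Fin N) (E : Fin M → (Fin (n + m) ↪ Fin N)) (hdisj : ∀ b a i, p a ≠ E b i) (hE : BlockDisjoint E)
    (t : Fin κ ↪ Fin P) (A : Language Bool) (w : QReg N) (x : QReg n) (hwx : ∀ b, w ∘ E b = padInput x m)
    (hw0 : ∀ j, w ((t.trans p) j) = false) (b : Fin M) (hb : (b : ℕ) < (oraclePositions gs).length)
    (hpre : pre b = ((oraclePositions gs)[(b : ℕ)]).1) (D : Set (List Bool)) [DecidablePred (· ∈ D)] :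
    (∑ y ∈ univ.filter (fun y : QReg N => queryOf ((oraclePositions gs)[(b : ℕ)]).2.2 (y ∘ E b) ∈ D),
        ‖((⟨(List.ofFn (t.trans p)).map hOn ++
            (List.finRange M).flatMap fun b => retarget p (E b) (hdisj b) (pre b)⟩ : QCircuit cliffordT N).toMatrix A *ᵥ
          basisState w) y‖ ^ 2) =
      (1 / 2 : ℝ) ^ κ * ∑ key : QReg κ,
        (queryWeights (prefixSlice A (List.ofFn (assignKey (t.trans p) w key ∘ p))) D gs
          (basisState (padInput x m)))[(b : ℕ)]'(by
            rw [queryWeights_eq_map_oraclePositions, List.length_map]; exact hb) := by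
  classical
  rw [sum_normSq_hadamards_flatMap_retarget_block_event pre p E hdisj hE t A w x hwx hw0 b
    (fun u => queryOf ((oraclePositions gs)[(b : ℕ)]).2.2 u ∈ D)]
  congr 1
  refine Finset.sum_congr rfl fun key _ => ?_
  rw [queryWeights_getElem _ _ _ _ _ hb, ← hpre, sum_ite_queryOf_eq_queryWeight]

end Literature.Computability.QuantumComplexity

end
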